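import Summits.ResolutionOfSingularities.ResolutionOfSingularities.Theorems.MarkedTransferCampaignW46FiniteExitBoundOfMeasure
import Literature.AlgebraicGeometry.Resolution.BlowupOffCentre
import HarnessLib

/-!
# [OURS · L1 W4.6 rung (i-a)′] Scheme glue for the finite-sequence exit bound: OFF THE CENTRE nothing changes, so the
# one-step fibre drop of a GERM-LOCAL measure reduces to its CENTRE clause (cell res-hironaka, LADDER-RESOLUTION rung L,
# D-0089; campaign s46, seat res-D-pv-046 AS res-L1-s46-pv-9; host route MarkedTransfer,
# `--supports stmt-ResolutionOfSingularities-16156 --as helper`; companion of `…W46FiniteExitBoundOfMeasure.lean` (this seat,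
# p497699), `…W46FiniteExitBound.lean` (res-L1-type-o1), `…W46PlaneIsolated.lean` (res-L1-s46-pv-1))

HONEST FRAMING. Nothing here is a statement of H. Hironaka's manuscript (2017-03-23, [Hironaka2017]) and nothing here
asserts that any statement of it holds. Everything is OURS bookkeeping over the campaign's typed finite permissible sequences,
plus TREE THEOREMS about blowing up away from the centre (`Literature/AlgebraicGeometry/Resolution/Blowups.lean`
`IsBlowup.isIso_compl` = Stacks 02OS; `BlowupOffCentre.lean`, `MonomialOrderReductionUnit.lean`, `StalkIdealLemmas.lean`).
AI review is weaker than expert review. No `sorry`; axioms standard.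

## What this file does

The run layer (`finLocalExitBound_of_stepMeasureDrop`, p497699) reduces rung (i-a)′ `PlaneIsolatedFinLocalExitBound` to ONE
per-point measure `μ(A, E, ξ) ∈ ℕ` with the one-step fibre drop: along one permissible blow-up `π` with centre `D` inside
the regime, for every `η ∈ Sing(E)` and every finset `t ⊆ Sing(E′) ∩ π⁻¹(η)`, `Σ_t μ′ ≤ μ(η)`, strictly if `η ∈ D`. This
file discharges the OFF-CENTRE half of that hypothesis once and for all, for measures which only see the GERM:

* `blowup_injOn_off_centre` — a blowing up is injective on the points lying over the complement of its centre (it is an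
  isomorphism there, `IsBlowup.isIso_compl`); so a finset of points over `η ∉ D` has at most one element.
* `stepMeasureDrop_of_offCentre_of_centre` — for ANY regime and ANY measure: «`μ′(ξ′) ≤ μ(π ξ′)` at singular points off the
  centre» + «strict fibre drop over the points OF the centre» ⇒ the one-step fibre drop (pure bookkeeping + the injectivity).
* `transform_germ_eq_off_centre` / `offCentre_eq_of_germLocal` — if `μ(A, E, ξ) = ν(𝒪_{Z,ξ}, J_ξ, b)` for a function `ν`
  of (local ring, ideal, exponent) INVARIANT UNDER RING ISOMORPHISMS, then off the centre `μ′(ξ′) = μ(π ξ′)`: the stalk map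
  `𝒪_{Z,π ξ′} → 𝒪_{Z′,ξ′}` is an isomorphism (`IsBlowup.isIso_stalkMap_of_not_mem_support`) carrying `J_{π ξ′}` onto the
  stalk of the controlled transform (`IsBlowup.stalkIdeal_controlledTransform_of_not_mem`, `stalkIdeal_comap_eq_map_stalkMap`),
  and the exponent `b` is unchanged (Def. 2.1).
* `planeIsolatedFinLocalExitBound_of_germLocal` — **THE REDUCED TARGET for the invariant layer (res-L1-s46-pv-8)**: for a
  ring-isomorphism-invariant `ν`, rung (i-a)′ `PlaneIsolatedFinLocalExitBound p K` follows from the single CENTRE INEQUALITY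
  «for one permissible blow-up `π : Z′ → Z` of the closed point `ξ ∈ Sing(E)` inside `regimePlaneIsolated` (both states
  surfaces with finite singular locus of closed points) and every finset `t` of points of `Sing(E′)` over `ξ`:
  `Σ_{ξ′ ∈ t} ν(𝒪_{Z′,ξ′}, J′_{ξ′}, b) < ν(𝒪_{Z,ξ}, J_ξ, b)`» (centres ARE closed points there,
  `IsPermissibleCentre.exists_eq_singleton_of_isolatedSing`); `planeIsolatedTerminates_of_germLocal` adds the rung in all
  its forms (résumé-free, literal, ∇-centred) via the companions.

So after this file the (β1)–(β3) content of the rung (res-L1-type-o1 02:49:39Z / res-plan-2 03:13:15Z on HOME/STATUS) is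
EXACTLY: a ring-isomorphism-invariant `ν(R, I, b) ∈ ℕ` on (two-dimensional regular local) germs and the displayed centre
inequality under one point blow-up — commutative algebra of the dim-2 regular local ring and its first neighbourhood plus the
identification of the points over `ξ`, no run bookkeeping and no off-centre case.

## References

* companions p497699 (run layer), p488284 (statement of record), p477752/p483951 (regime, `sing_subset_of_transform`).
* U. Görtz, T. Wedhorn, *Algebraic Geometry I* (2nd ed. 2020), Prop. 13.91 (3); The Stacks Project, Tag 02OS — the blow-up
  is an isomorphism away from its centre (tree theorems cited above). [GortzWedhorn2020] [StacksProject]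
-/

noncomputable section

set_option linter.dupNamespace false -- mandated namespace of this single-conjunct summit

open CategoryTheory AlgebraicGeometry TopologicalSpace

namespace Summit.ResolutionOfSingularities.ResolutionOfSingularities.Theorems

namespace CampaignW46

open Literature.AlgebraicGeometry.Resolution
open Literature.AlgebraicGeometry.Hironaka2017.S02Preliminaries
open Scheme.IdealSheafData

universe u

/-! ## Off the centre a blowing up is injective on points -/

/-- A blowing up `π : X′ → X` along `C` is injective on `π⁻¹(X ∖ V(C))`: its restriction over the open complement of the
centre is an isomorphism (`IsBlowup.isIso_compl`), in particular an open embedding. [cite: StacksProject, Tag 02OS] -/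
theorem blowup_injOn_off_centre {X X' : Scheme.{u}} {π : X' ⟶ X} {C : X.IdealSheafData} (hπ : IsBlowup π C) :
    Set.InjOn (fun x' : X' => π x') ((fun x' : X' => π x') ⁻¹' (C.support : Set X)ᶜ) := by
  set U : X.Opens := ⟨(C.support : Set X)ᶜ, C.support.isClosed.isOpen_compl⟩ with hU
  haveI : IsIso (π ∣_ U) := hπ.isIso_compl
  intro a ha b hb hab
  have ha' : a ∈ π ⁻¹ᵁ U := ha
  have hb' : b ∈ π ⁻¹ᵁ U := hb
  have heq : (π ∣_ U) ⟨a, ha'⟩ = (π ∣_ U) ⟨b, hb'⟩ := by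
    apply Subtype.ext
    rw [morphismRestrict_base_coe, morphismRestrict_base_coe]
    exact hab
  exact congrArg Subtype.val ((π ∣_ U).isOpenEmbedding.injective heq)

/-- Over a point NOT on the closed centre `D`, a blowing up along the reduced ideal of `D` has at most one point: a finset
of points all mapping to such an `η` has at most one element. [cite: StacksProject, Tag 02OS] -/
theorem card_le_one_of_fibre_off_centre {X X' : Scheme.{u}} {π : X' ⟶ X} {D : Closeds X}
    (hπ : IsBlowup π (vanishingIdeal D)) {η : X} (hη : η ∉ (D : Set X)) (t : Finset X')
    (ht : ∀ ξ' ∈ t, π ξ' = η) : t.card ≤ 1 := by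
  refine Finset.card_le_one.2 fun a ha b hb => ?_
  have hsupp : ∀ ξ' ∈ t, ξ' ∈ (fun x' : X' => π x') ⁻¹' ((vanishingIdeal D).support : Set X)ᶜ := by
    intro ξ' hξ'
    show π ξ' ∈ ((vanishingIdeal D).support : Set X)ᶜ
    rw [coe_support_vanishingIdeal, ht ξ' hξ']
    exact hη
  exact blowup_injOn_off_centre hπ (hsupp a ha) (hsupp b hb) ((ht a ha).trans (ht b hb).symm)

variable {p : ℕ} [Fact p.Prime] {K : Type u} [Field K] [CharP K p]

/-! ## The one-step fibre drop from its off-centre and centre halves (any regime, any measure) -/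

/-- [OURS · L1 W4.6 rung (i-a)′] NOT a statement of the manuscript. **The one-step fibre drop from two halves.** For any
regime `Rg` and any per-point measure `μ`: if along every permissible step inside `Rg` (i) `μ′(ξ′) ≤ μ(π ξ′)` for the singular
points `ξ′` off the centre, and (ii) for every point `η` OF the centre and every finset `t ⊆ Sing(E′)` over `η`,
`Σ_t μ′ < μ(η)`, then `μ` has the one-step fibre drop inside `Rg` (the hypothesis of `finLocalExitBound_of_stepMeasureDrop`):
over `η ∉ D` a finset over `η` has at most one point (`card_le_one_of_fibre_off_centre`). [folklore] -/
theorem stepMeasureDrop_of_offCentre_of_centre {Rg : Regime p K}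
    (μ : ∀ A : AmbientDatum p K, IdealExponent A.Z → A.Z → ℕ)
    (hoff : ∀ (A A' : AmbientDatum p K) (E : IdealExponent A.Z) (E' : IdealExponent A'.Z) (D : Closeds A.Z)
      (π : A'.Z ⟶ A.Z), Rg A E → Rg A' E' → E.IsStandard → E'.IsStandard →
      E.IsPermissibleCentre A.hom D → A'.hom = π ≫ A.hom → IsBlowup π (vanishingIdeal D) →
      E' = E.transform π D →
        ∀ ξ' : A'.Z, π ξ' ∉ (D : Set A.Z) → ξ' ∈ E'.sing → μ A' E' ξ' ≤ μ A E (π ξ'))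
    (hcentre : ∀ (A A' : AmbientDatum p K) (E : IdealExponent A.Z) (E' : IdealExponent A'.Z) (D : Closeds A.Z)
      (π : A'.Z ⟶ A.Z), Rg A E → Rg A' E' → E.IsStandard → E'.IsStandard →
      E.IsPermissibleCentre A.hom D → A'.hom = π ≫ A.hom → IsBlowup π (vanishingIdeal D) →
      E' = E.transform π D →
        ∀ η ∈ (D : Set A.Z), ∀ t : Finset A'.Z, (∀ ξ' ∈ t, ξ' ∈ E'.sing ∧ π ξ' = η) →
          t.sum (μ A' E') < μ A E η) :
    ∀ (A A' : AmbientDatum p K) (E : IdealExponent A.Z) (E' : IdealExponent A'.Z) (D : Closeds A.Z)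
      (π : A'.Z ⟶ A.Z), Rg A E → Rg A' E' → E.IsStandard → E'.IsStandard →
      E.IsPermissibleCentre A.hom D → A'.hom = π ≫ A.hom → IsBlowup π (vanishingIdeal D) →
      E' = E.transform π D →
        ∀ η ∈ E.sing, ∀ t : Finset A'.Z, (∀ ξ' ∈ t, ξ' ∈ E'.sing ∧ π ξ' = η) →
          t.sum (μ A' E') ≤ μ A E η ∧ (η ∈ (D : Set A.Z) → t.sum (μ A' E') < μ A E η) := by
  intro A A' E E' D π hRg hRg' hE hE' hD hhom hπ hEE' η _hη t ht
  by_cases hηD : η ∈ (D : Set A.Z)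
  · have hlt := hcentre A A' E E' D π hRg hRg' hE hE' hD hhom hπ hEE' η hηD t ht
    exact ⟨hlt.le, fun _ => hlt⟩
  · refine ⟨?_, fun h => absurd h hηD⟩
    have hcard := card_le_one_of_fibre_off_centre hπ hηD t fun ξ' hξ' => (ht ξ' hξ').2
    rcases t.eq_empty_or_nonempty with rfl | ⟨ξ'₀, hξ'₀⟩
    · rw [Finset.sum_empty]
      exact Nat.zero_le _
    · have ht₀ : t = {ξ'₀} :=
        Finset.eq_singleton_iff_unique_mem.2 ⟨hξ'₀, fun ξ' hξ' => Finset.card_le_one.1 hcard ξ' hξ' ξ'₀ hξ'₀⟩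
      rw [ht₀, Finset.sum_singleton]
      obtain ⟨hsing₀, hπ₀⟩ := ht ξ'₀ hξ'₀
      have h := hoff A A' E E' D π hRg hRg' hE hE' hD hhom hπ hEE' ξ'₀ (by rw [hπ₀]; exact hηD) hsing₀
      rwa [hπ₀] at h

/-! ## Germ-local measures: off the centre nothing changes -/

/-- **Off the centre the germ of the transform is the germ downstairs.** For a blowing up `π : Z′ → Z` along the reduced
ideal of a closed `D` and a point `ξ′` with `π ξ′ ∉ D`, the stalk map `𝒪_{Z, π ξ′} → 𝒪_{Z′, ξ′}` is a ring isomorphism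
carrying the stalk of `J` onto the stalk of the controlled transform `(J 𝒪_{Z′} : (𝓘_D 𝒪_{Z′})^b)` (tree:
`IsBlowup.isIso_stalkMap_of_not_mem_support`, `IsBlowup.stalkIdeal_controlledTransform_of_not_mem`,
`stalkIdeal_comap_eq_map_stalkMap`). [cite: StacksProject, Tag 02OS] -/
theorem transform_germ_eq_off_centre {Z Z' : Scheme.{u}} {π : Z' ⟶ Z} {D : Closeds Z}
    (hπ : IsBlowup π (vanishingIdeal D)) (E : IdealExponent Z) {ξ' : Z'} (hξ' : π ξ' ∉ (D : Set Z)) :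
    ∃ e : Z.presheaf.stalk (π ξ') ≃+* Z'.presheaf.stalk ξ',
      (stalkIdeal E.J (π ξ')).map e = stalkIdeal (E.transform π D).J ξ' ∧ (E.transform π D).b = E.b := by
  have hx : π ξ' ∉ ((vanishingIdeal D).support : Set Z) := by rwa [coe_support_vanishingIdeal]
  haveI := hπ.isIso_stalkMap_of_not_mem_support hx
  refine ⟨(asIso (π.stalkMap ξ')).commRingCatIsoToRingEquiv, ?_, rfl⟩
  show _ = stalkIdeal (controlledTransform π (vanishingIdeal D) E.J E.b) ξ'
  rw [hπ.stalkIdeal_controlledTransform_of_not_mem E.J E.b hx, stalkIdeal_comap_eq_map_stalkMap]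
  rfl

/-- [OURS · L1 W4.6 rung (i-a)′] NOT a statement of the manuscript. **Germ-local measures do not change off the centre.**
If `μ(A, E, ξ) = ν(𝒪_{Z,ξ}, J_ξ, b)` for a function `ν` of (local ring, ideal, exponent) invariant under ring isomorphisms,
then along any blowing up of a closed centre `D`, `μ(A′, E′, ξ′) = μ(A, E, π ξ′)` at every `ξ′` off the centre
(`transform_germ_eq_off_centre`). [folklore] -/
theorem offCentre_eq_of_germLocal
    (ν : ∀ (R : Type u) [CommRing R], Ideal R → ℕ → ℕ)
    (hν : ∀ (R S : Type u) [CommRing R] [CommRing S] (e : R ≃+* S) (I : Ideal R) (b : ℕ),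
      ν S (I.map e) b = ν R I b)
    (μ : ∀ A : AmbientDatum p K, IdealExponent A.Z → A.Z → ℕ)
    (hμν : ∀ (A : AmbientDatum p K) (E : IdealExponent A.Z) (ξ : A.Z),
      μ A E ξ = ν (A.Z.presheaf.stalk ξ) (stalkIdeal E.J ξ) E.b)
    {A A' : AmbientDatum p K} (E : IdealExponent A.Z) {D : Closeds A.Z} {π : A'.Z ⟶ A.Z}
    (hπ : IsBlowup π (vanishingIdeal D)) {ξ' : A'.Z} (hξ' : π ξ' ∉ (D : Set A.Z)) :
    μ A' (E.transform π D) ξ' = μ A E (π ξ') := by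
  obtain ⟨e, he, hb⟩ := transform_germ_eq_off_centre hπ E hξ'
  rw [hμν, hμν, ← he, hb, hν]

/-! ## The reduced target for the invariant layer: a germ invariant and its centre inequality -/

/-- [OURS · L1 W4.6 rung (i-a)′] NOT a statement of the manuscript. **Rung (i-a)′ from a GERM INVARIANT with the CENTRE
INEQUALITY.** Let `ν(R, I, b) ∈ ℕ` be a function of (local ring, ideal, exponent) invariant under ring isomorphisms, and
`μ(A, E, ξ) = ν(𝒪_{Z,ξ}, J_ξ, b)`. Suppose that for every permissible blow-up `π : Z′ → Z` of a closed point `ξ ∈ Sing(E)`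
inside `regimePlaneIsolated` (both states surfaces with finite singular locus of closed points; `E` and the transform `E′`
standard) and every finset `t` of points of `Sing(E′)` over `ξ`: `Σ_{ξ′ ∈ t} μ(A′, E′, ξ′) < μ(A, E, ξ)`. Then
`PlaneIsolatedFinLocalExitBound p K` (with `β := μ`): centres in the regime are closed points
(`IsPermissibleCentre.exists_eq_singleton_of_isolatedSing`), the off-centre half is `offCentre_eq_of_germLocal`, and the run
layer is `planeIsolatedFinLocalExitBound_of_stepMeasureDrop` (p497699). [folklore] -/
theorem planeIsolatedFinLocalExitBound_of_germLocal
    (ν : ∀ (R : Type u) [CommRing R], Ideal R → ℕ → ℕ)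
    (hν : ∀ (R S : Type u) [CommRing R] [CommRing S] (e : R ≃+* S) (I : Ideal R) (b : ℕ),
      ν S (I.map e) b = ν R I b)
    (μ : ∀ A : AmbientDatum p K, IdealExponent A.Z → A.Z → ℕ)
    (hμν : ∀ (A : AmbientDatum p K) (E : IdealExponent A.Z) (ξ : A.Z),
      μ A E ξ = ν (A.Z.presheaf.stalk ξ) (stalkIdeal E.J ξ) E.b)
    (hcentre : ∀ (A A' : AmbientDatum p K) (E : IdealExponent A.Z) (E' : IdealExponent A'.Z) (ξ : A.Z)
      (hξ : IsClosed ({ξ} : Set A.Z)) (π : A'.Z ⟶ A.Z),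
      regimePlaneIsolated A E → regimePlaneIsolated A' E' → E.IsStandard → E'.IsStandard → ξ ∈ E.sing →
      E.IsPermissibleCentre A.hom ⟨{ξ}, hξ⟩ → A'.hom = π ≫ A.hom → IsBlowup π (vanishingIdeal ⟨{ξ}, hξ⟩) →
      E' = E.transform π ⟨{ξ}, hξ⟩ →
        ∀ t : Finset A'.Z, (∀ ξ' ∈ t, ξ' ∈ E'.sing ∧ π ξ' = ξ) → t.sum (μ A' E') < μ A E ξ) :
    PlaneIsolatedFinLocalExitBound p K := by
  refine planeIsolatedFinLocalExitBound_of_stepMeasureDrop μ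
    (stepMeasureDrop_of_offCentre_of_centre (Rg := regimePlaneIsolated) μ ?_ ?_)
  · -- off the centre: germ-local measures do not change
    intro A A' E E' D π _ _ _ _ _ _ hπ hEE' ξ' hξ' _
    rw [hEE', offCentre_eq_of_germLocal ν hν μ hμν E hπ hξ']
  · -- on the centre: the centre is a closed point `ξ ∈ Sing(E)`
    intro A A' E E' D π hRg hRg' hE hE' hD hhom hπ hEE' η hη t ht
    obtain ⟨ξ, hξS, hξcl, hDξ⟩ := IsPermissibleCentre.exists_eq_singleton_of_isolatedSing hD hRg.2
    have hDeq : D = ⟨{ξ}, hξcl⟩ := Closeds.ext hDξ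
    subst hDeq
    have hηξ : η = ξ := hη
    subst hηξ
    exact hcentre A A' E E' η hξcl π hRg hRg' hE hE' hξS hD hhom hπ hEE' t ht

/-- **The rung in all its forms from a germ invariant with the centre inequality** (assembly with the companions):
résumé-free termination on surfaces with isolated singular locus and the typed rungs for every notion instance, literal and
∇-centred. [folklore] -/
theorem planeIsolatedTerminates_of_germLocal
    (ν : ∀ (R : Type u) [CommRing R], Ideal R → ℕ → ℕ)
    (hν : ∀ (R S : Type u) [CommRing R] [CommRing S] (e : R ≃+* S) (I : Ideal R) (b : ℕ),
      ν S (I.map e) b = ν R I b)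
    (μ : ∀ A : AmbientDatum p K, IdealExponent A.Z → A.Z → ℕ)
    (hμν : ∀ (A : AmbientDatum p K) (E : IdealExponent A.Z) (ξ : A.Z),
      μ A E ξ = ν (A.Z.presheaf.stalk ξ) (stalkIdeal E.J ξ) E.b)
    (hcentre : ∀ (A A' : AmbientDatum p K) (E : IdealExponent A.Z) (E' : IdealExponent A'.Z) (ξ : A.Z)
      (hξ : IsClosed ({ξ} : Set A.Z)) (π : A'.Z ⟶ A.Z),
      regimePlaneIsolated A E → regimePlaneIsolated A' E' → E.IsStandard → E'.IsStandard → ξ ∈ E.sing →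
      E.IsPermissibleCentre A.hom ⟨{ξ}, hξ⟩ → A'.hom = π ≫ A.hom → IsBlowup π (vanishingIdeal ⟨{ξ}, hξ⟩) →
      E' = E.transform π ⟨{ξ}, hξ⟩ →
        ∀ t : Finset A'.Z, (∀ ξ' ∈ t, ξ' ∈ E'.sing ∧ π ξ' = ξ) → t.sum (μ A' E') < μ A E ξ) :
    PlaneIsolatedPermissiblyTerminates p K ∧ PlaneIsolatedTerminates p K ∧ PlaneIsolatedTerminatesNabla p K :=
  have h := planeIsolatedFinLocalExitBound_of_germLocal ν hν μ hμν hcentre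
  ⟨planeIsolatedPermissiblyTerminates_of_finLocalExitBound h, planeIsolatedTerminatesNabla_of_finLocalExitBound h⟩

end CampaignW46

end Summit.ResolutionOfSingularities.ResolutionOfSingularities.Theorems

end
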